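import Literature.Barriers.CriticalPhenomena.PlaquetteWalkHoleRootHoleColumnAdjacentWitness
import HarnessLib

/-!
# Barrier catalogue (SAWScalingLimit): the WOUND LEVEL-`7` WITNESS at the hole-column cell JUST BELOW THE HOLE — the existence hypothesis of «VF ≢ 0 next to the hole»
discharged below the hole as well («HOLE-COLUMN WITNESS BELOW»)

`Z → ∞` limit model of the printed Yang–Baxter weights [GlazmanManolescu2019, §1, eq. (1)]; the «RECTANGLE COEFFICIENT» line (b-engine-1 g29). The row mirror of
`PlaquetteWalkHoleRootHoleColumnAdjacentWitness` in the reference frame (root plaquette `w42 = (4,2)`, hole `(3,2)`): the kind-(a) member at the cell `(3,1)` just BELOW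
the hole — east to `p₁ = (5,2)`, south, the hook `(5,1)`, west along row `1` STRAIGHT through `(3,1)`, up column `2` across the western root row, east along row `3` over the
hole, south down column `6` (ONE eastern-ray crossing), west along the bottom row `0`, and up into `(3,1)` through its `S` side — `18` arcs, `7` isolated turns, cost `7`.

* `holeColBlockBelow42`, `holeColMidsBelow42`, `holeColWalkBelow`, `ωHCb`, `ωHCb_cert` — the reference witness and its kernel-decided certificates;
* ★★★★ `exists_wound_cost_seven_holeColumn_adjacent_below` — every face list containing `holeColBlockBelow w` carries, at `(w.1 − 1, w.2 − 1)`, a WOUND class-`B2a` walk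
  from `w.side W` of limit cost `7` with a straight first arc and a slanted end;
* ★★★★★ `vertexFunctional_printed_zero_set_finite_holeColumn_adjacent_below_of_block` — `PlaquetteWalkHoleRootHoleColumnAdjacentVF`'s theorem below the hole with
  `hex` DISCHARGED: for `Dl ⊇ holeColBlockBelow w` missing the hole, **if every cost-`7` extension of a wound `NS` member at `(w.1 − 1, w.2 − 1)` has
  `limitWeight ∈ (√2)⁷·{1, ζ⁸, ζ²⁰, ζ²⁸}`, then `VF_{Dl}(w.side W, (w.1 − 1, w.2 − 1); ·)` has finitely many zeros in `(0, π)`**.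

[GlazmanManolescu2019 §1 (definition of the model), Fig. 1, eq. (1), Lemma 2.1, Remark 2.2, §4.2; Glazman2015WeightedSAW Lemma 3.1 (proof); CourantRobbins1958 Ch. V App. §2.]
-/

noncomputable section

open Set Function Complex

open private IsNS from Literature.Probability.RandomPlanarGeometry.YangBaxterSAWGeneralDomain

namespace Literature.Barriers.CriticalPhenomena.PlaquetteWalk

open Literature.Probability.RandomPlanarGeometry.SAW.YangBaxter
open Real Complex

/-! ## §1 The reference witness at the root plaquette `(4,2)`: the kind-(a) member at the hole-column cell `(3,1)` -/

section Reference

/-- The block of the hole-column witness below the hole: the `18` faces it visits; never the hole `(3,2)`. [cite: GlazmanManolescu2019, §2.1 (finite domains of faces)] -/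
def holeColBlockBelow42 : List Face :=
  [(4,2), (5,2), (5,1), (4,1), (3,1), (2,1), (2,2), (2,3), (3,3), (4,3), (5,3), (6,3), (6,2), (6,1), (6,0), (5,0), (4,0), (3,0)]

/-- The mid-edges of the hole-column witness below the hole (the row mirror of `holeColMids42`). [cite: GlazmanManolescu2019, §1 (definition of the model), Fig. 1] -/
def holeColMidsBelow42 : List MidEdge :=
  [.vert 4 2, .vert 5 2, .slant 5 2, .vert 5 1, .vert 4 1, .vert 3 1, .slant 2 2, .slant 2 3, .vert 3 3, .vert 4 3, .vert 5 3, .vert 6 3, .slant 6 3,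
    .slant 6 2, .slant 6 1, .vert 6 0, .vert 5 0, .vert 4 0, .slant 3 1]

/-- The hole-column witness below the hole as a walk of its block, from the root `(4,2).side W` to the `S` side of `(3,1)`.
[cite: GlazmanManolescu2019, §1 (definition of the model), Fig. 1] -/
def holeColWalkBelow : YBWalk (dom holeColBlockBelow42) (w42.side .W) (Face.side ((3 : ℤ), (1 : ℤ)) .S) where
  mids := holeColMidsBelow42
  head_eq := by decide
  getLast_eq := by decide
  nodup := by decide
  arc_mem := arc_mem_of_check (by decide)
  isChain := by decide
  noncross := noncross_of_check (by decide)

/-- The hole-column witness below the hole with its end side `S`. [cite: GlazmanManolescu2019, Lemma 2.1 (walks entering the rhombus through a given side)] -/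
def ωHCb : ΩG (dom holeColBlockBelow42) (w42.side .W) ((3 : ℤ), (1 : ℤ)) := ⟨.S, holeColWalkBelow⟩

/-- Certificates of the hole-column witness below the hole: first hit `4`, `18` arcs, no later arc in the rhombus `(3,1)`, ONE eastern-ray crossing (odd), STRAIGHT first
arc, limit cost `7`. [cite: Glazman2015WeightedSAW, Lemma 3.1 (proof, pp. 6–7)] [cite: CourantRobbins1958, Ch. V Appendix §2 (the even–odd rule)] [cite: GlazmanManolescu2019, §1, eq. (1); Remark 2.2] -/
theorem ωHCb_cert : ωHCb.2.firstHitG = 4 ∧ ωHCb.2.arcs.length = 18 ∧ (∀ j < 18, 4 < j → ωHCb.2.fc j ≠ ((3 : ℤ), (1 : ℤ))) ∧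
    Odd ((Finset.range 14).filter fun j => eastRayB w42 (ωHCb.2.nth (4 + j + 1)) = true).card ∧
    arcKind (ωHCb.2.sIn 4) (ωHCb.2.sOut 4) = .straight ∧ cost (slotOfSide ωHCb.1) ωHCb.2.mids = 7 := by
  refine ⟨by decide, by decide, by decide, by decide, by decide, by decide⟩

end Reference

/-! ## §2 Translation: the witness at `(w.1 − 1, w.2 − 1)` and `VF ≢ 0` below the hole modulo the extensions -/

section Translate

variable {Dl : List Face} {w : Face}

/-- The hole-column witness block below the hole at the root plaquette `w`: the translate of `holeColBlockBelow42`.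
[cite: GlazmanManolescu2019, §2.1, §4.2 (translation invariance)] -/
def holeColBlockBelow (w : Face) : List Face := holeColBlockBelow42.map (Face.shiftBy (refShift w))

/-- The reference witness below the hole in the back-translated list containing its block: class `B2a`, odd eastern-ray count, straight first arc, cost `7`, end `S`.
[cite: Glazman2015WeightedSAW, Lemma 3.1 (proof, pp. 6–7)] [cite: CourantRobbins1958, Ch. V Appendix §2 (the even–odd rule)] -/
private theorem refWitnessHCb (hB₀ : ∀ c ∈ holeColBlockBelow42, c ∈ Dl.map (Face.shiftBy (-refShift w))) :
    ∃ (ω₀ : ΩG (dom (Dl.map (Face.shiftBy (-refShift w)))) (w42.side .W) ((3 : ℤ), (1 : ℤ))) (_ : ω₀.IsB2a),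
      Odd ((Finset.range ω₀.Mv).filter fun j => eastRayB w42 (ω₀.2.nth (ω₀.2.firstHitG + j + 1)) = true).card ∧
      arcKind (ω₀.2.sIn ω₀.2.firstHitG) (ω₀.2.sOut ω₀.2.firstHitG) = .straight ∧ cost (slotOfSide ω₀.1) ω₀.2.mids = 7 ∧ (ω₀.1 = .N ∨ ω₀.1 = .S) := by
  obtain ⟨hF, hn, hfc, hodd, hstr, hc⟩ := ωHCb_cert
  let ω₀ : ΩG (dom (Dl.map (Face.shiftBy (-refShift w)))) (w42.side .W) ((3 : ℤ), (1 : ℤ)) := ⟨.S, holeColWalkBelow.mapDomain fun c hc => hB₀ c hc⟩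
  have hF' : ω₀.2.firstHitG = 4 := hF
  have hn' : ω₀.2.arcs.length = 18 := hn
  have h₀ : ω₀.IsB2a := by
    refine ΩG.isB2a_of_forall_fc_ne (by rw [hF', hn']; omega) fun j hj1 hj2 => ?_
    rw [hF'] at hj1; rw [hn'] at hj2
    exact hfc j hj2 hj1
  have hM : ω₀.Mv = 14 := by unfold ΩG.Mv; rw [hF', hn']
  exact ⟨ω₀, h₀, by rw [hM, hF']; exact hodd, by rw [hF']; exact hstr, hc, Or.inr rfl⟩

/-- ★★★★ **A WOUND LEVEL-`7` MEMBER AT THE CELL JUST BELOW THE HOLE, EVERY POSITION.** Every face list containing `holeColBlockBelow w` carries, at `(w.1 − 1, w.2 − 1)`, a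
class-`B2a` walk from the root `w.side W` that is WOUND, crosses the rhombus straight at its first arc, has limit cost `7` and a slanted end.
[cite: GlazmanManolescu2019, §4.2 (translation invariance), Lemma 2.1; §1 eq. (1)] [cite: Glazman2015WeightedSAW, Lemma 3.1 (proof, pp. 6–7)]
[cite: CourantRobbins1958, Ch. V Appendix §2 (the even–odd rule)] -/
theorem exists_wound_cost_seven_holeColumn_adjacent_below (hB : ∀ c ∈ holeColBlockBelow w, c ∈ Dl)
    (hr : RootedFace (dom Dl) (w.side .W) (w.1 - 1, w.2 - 1)) :
    ∃ (ω : ΩG (dom Dl) (w.side .W) (w.1 - 1, w.2 - 1)) (h : ω.IsB2a), ω.AJ hr h (toC (midPt (w.side .W))) ≠ 0 ∧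
      arcKind (ω.2.sIn ω.2.firstHitG) (ω.2.sOut ω.2.firstHitG) = .straight ∧ cost (slotOfSide ω.1) ω.2.mids = 7 ∧ (ω.1 = .N ∨ ω.1 = .S) := by
  have hB₀ := block42_mem_of_block_mem (B := holeColBlockBelow42) hB
  have hrr : Face.shiftBy (refShift w) (((3 : ℤ), (1 : ℤ)) : Face) = (w.1 - 1, w.2 - 1) := by
    have := shiftBy_refShift_col w (-1) (-1)
    rw [show ((4 : ℤ) + -1, (2 : ℤ) + -1) = (((3 : ℤ), (1 : ℤ)) : Face) by norm_num] at this
    rw [this]; exact Prod.ext (by simp only; omega) (by simp only; omega)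
  obtain ⟨ω₀, h₀, hodd, hstr, hc, hz⟩ := refWitnessHCb hB₀
  exact ΩG.exists_wound_cost_seven_straight_shift (shiftBy_refShift_root w) hrr hr
    (rootedFace_refShift_back' (shiftBy_refShift_root w) hrr hr) ω₀ h₀ hodd hstr hc hz

open Classical in
/-- ★★★★★ **`VF ≢ 0` JUST BELOW THE HOLE, MODULO THE EXTENSIONS' PHASES — EXISTENCE DISCHARGED.** For every finite face list `Dl` missing the hole `(w.1 − 1, w.2)` and
containing `holeColBlockBelow w`: IF every cost-`7` extension `ext₃ ω` of a wound `NS` member at `r = (w.1 − 1, w.2 − 1)` has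
`limitWeight ∈ {(√2)⁷, (√2)⁷ζ⁸, (√2)⁷ζ²⁰, (√2)⁷ζ²⁸}`, THEN `θ ↦ VF_{Dl}(w.side W, r; θ)` has finitely many zeros in `(0, π)` (at most `4·maxExp − 6`).
[cite: GlazmanManolescu2019, Lemma 2.1 (proof: the groups) and eq. (1); Remark 2.2; §4.2] [cite: Glazman2015WeightedSAW, Lemma 3.1 (proof, pp. 6–7)] -/
theorem vertexFunctional_printed_zero_set_finite_holeColumn_adjacent_below_of_block (hh : holeFaceW w ∉ dom Dl)
    (hB : ∀ c ∈ holeColBlockBelow w, c ∈ Dl) (hr : RootedFace (dom Dl) (w.side .W) (w.1 - 1, w.2 - 1))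
    (hB2b : ∀ ω ∈ (ΩG.setB2a (dom Dl) (w.side .W) (w.1 - 1, w.2 - 1)).filter (fun ω => ¬ω.Unwound hr),
      IsNS ω hr → cost (slotOfSide (ω.ext₃ hr).1) (ω.ext₃ hr).2.mids = 7 →
        (limitWeight (slotOfSide (ω.ext₃ hr).1) (ω.ext₃ hr).2.mids = ((Real.sqrt 2 : ℝ) : ℂ) ^ 7 ∨
          limitWeight (slotOfSide (ω.ext₃ hr).1) (ω.ext₃ hr).2.mids = ((Real.sqrt 2 : ℝ) : ℂ) ^ 7 * zeta32 ^ 8 ∨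
          limitWeight (slotOfSide (ω.ext₃ hr).1) (ω.ext₃ hr).2.mids = ((Real.sqrt 2 : ℝ) : ℂ) ^ 7 * zeta32 ^ 20 ∨
          limitWeight (slotOfSide (ω.ext₃ hr).1) (ω.ext₃ hr).2.mids = ((Real.sqrt 2 : ℝ) : ℂ) ^ 7 * zeta32 ^ 28)) :
    {θ ∈ Set.Ioo 0 π | vertexFunctional (printedWeights θ) tFiveEighths (ybCoeff θ) Dl (w.side .W) (w.1 - 1, w.2 - 1) = 0}.Finite ∧
      {θ ∈ Set.Ioo 0 π | vertexFunctional (printedWeights θ) tFiveEighths (ybCoeff θ) Dl (w.side .W) (w.1 - 1, w.2 - 1) = 0}.ncard ≤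
        4 * maxExp Dl (w.side .W) (w.1 - 1, w.2 - 1) + 1 - 7 := by
  refine vertexFunctional_printed_zero_set_finite_holeColumn_adjacent_below Dl hh hr rfl rfl hB2b ?_
  obtain ⟨ω, h, hA, -, hc, -⟩ := exists_wound_cost_seven_holeColumn_adjacent_below hB hr
  refine ⟨ω, ?_, Or.inl hc⟩
  rw [Finset.mem_filter, ΩG.unwound_iff_AJ_root_eq_zero]
  refine ⟨?_, fun hall => hA (hall h)⟩
  unfold ΩG.setB2a
  rw [Finset.mem_filter]
  exact ⟨Finset.mem_univ _, h⟩

end Translate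

end Literature.Barriers.CriticalPhenomena.PlaquetteWalk
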